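import Summits.BirchSwinnertonDyer.BirchSwinnertonDyer.Theorems.GoldfeldAllTwistsTwoConverseTwinEvenTwistLValue
import Literature.NumberTheory.DiophantineGeometry.LindMordellQuarticsHassePrincipleFailure
import HarnessLib

set_option linter.dupNamespace false -- namespace `…BirchSwinnertonDyer.BirchSwinnertonDyer…` is the cell's (D-0017 nested layout)
set_option autoImplicit false

/-!
# Cell C7 (β, `p ≡ 1 (mod 8)`), file F1a = (M7a) local part: the homogeneous space `w² = p u⁴ − 84p u²z² − 28p z⁴` of the even
# partner `49a1^{(2p)}` is EVERYWHERE LOCALLY SOLUBLE (the class `p` of `S' = S(−84p, −28p²)`)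

Cell `bsd-goldfeld`, seat `bsd-goldfeld-s1p-c3x` (gen 12); planner ORDER «C7-SCOPING» (RULING (cccxxvi)), memo `HOME/C7-HORIZON.md` §2 (M7a) /
§4 F1 (part a, the local computations) — the STOP/GO file of the C7 line. `--supports stmt-BirchSwinnertonDyer-20044` as a HELPER (planner RULING (cccxxxviii), TRANCHE C7-1). Theses-free; theorems only; no definition,
no named fact, no `sorry`: FACT-FREE (UNCONDITIONAL).

OBJECT. For a prime `p ≡ 1 (mod 8)` with `(−7/p) = +1` and `−7` a fourth power mod `p` (type β) — cell C7 of the mixed two-prime family — the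
two-torsion model `E_{2p} : y² = x³ + 42p·x² + 448p²·x` of `49a1^{(2p)}` has `S' = S(−84p, −28p²) ∋ p`: the homogeneous space
`w² = p u⁴ − 84p u²z² − 28p z⁴` is everywhere locally soluble (`prime_mem_twoIsogenySelmerGroup'_twoPosTwist_pOne`). With `1` and `−7`
(`(−28p²)/(−7) = (2p)²`) this gives **`4 ≤ #S'`** (`four_le_card_twoIsogenySelmerGroup'_twoPosTwist_pOne`; `#S'` is a power of `2`), and
Silverman's count `2^{dim S'} = #α'(E'(ℚ))·#Ш(E)[Ξ]` with `#α(E(ℚ))·#α'(E'(ℚ)) = 2^{rank + 2}`, `#α ≥ 2` (`α(T) = [448p²] = [7] ≠ 1`) gives,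
WHEN `rank E_{2p}(ℚ) = 0`, a non-zero class of `Ш(E_{2p})` killed by `2` (`exists_mem_sha_two_twoTorsionModel_twoPosTwist_pOne`), transported to
every model `W` of `49a1^{(2p)}` (`exists_mem_sha_two_twoPosTwist_pOne`). This is the flipped bit (M7) of the C7 line: on C4/C6/C8
(`p ≡ 5 (mod 8)`) LINE C3 proved `#S ≤ 2`, `#S' ≤ 2`, `Ш[2] = 0`; on C7 `(#S, #S') = (8, 4)` (kit j312848/j312976, 70/70) and `Ш[2] ≠ 0`
whenever `L(49a1^{(2p)}, 1) ≠ 0`.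

LOCAL SOLUBILITY of `w² = p u⁴ − 84p u²z² − 28p z⁴` (the template is the tree's `LindMordellQuarticsHassePrincipleFailure`, `S^{(φ)}(y² = x³ + px)`
for `p ≡ 1 (mod 8)`): over `ℝ` the point `(1, 0, √p)`; at a prime `ℓ ≥ 5`, `ℓ ∉ {7, p}`: good reduction, `Δ = −2²⁶·7³·p⁶`, the tree's PROVED
`BinaryQuartic.isSoluble_padic_of_not_dvd_disc`; at `ℓ = 3`: `(1, 0, √p)` if `p ≡ 1 (mod 3)`, `(0, 1, √(−28p))` if `p ≡ 2 (mod 3)`; at `ℓ = 7`: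
`(1, 0, √p)`, `(p/7) = +1`; at `ℓ = 2`: `(1, 0, √p)`, `p ≡ 1 (mod 8)` a `2`-adic square; at `ℓ = p` (the ONLY place where type β enters): the ROOT
`t₀ = c³ + 3c` of `g(t) = t⁴ − 84t² − 28 = (t² − 42)² − 2⁸·7` modulo `p`, where `c⁴ = 7` (`c = x(1+i)/a`, `x⁴ = −7`, `i² = −1`, `a² = 2`),
`g(t₀) = (c⁸ + 12c⁶ + 61c⁴ + 108c² + 4)(c⁴ − 7) = 0`, `g'(t₀) = 4t₀(t₀² − 42) = 64c³(c² + 3) ≠ 0`, lifts by Hensel (the tree's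
`BinaryQuartic.exists_eval_eq_zero_of_simple_root`) to `t ∈ ℤ_p` with `g(t) = 0`, i.e. the point `(t, 1, 0)`.

NUMERICS (kit j312848 + j312976, PARI 2.17.3; evidence on item 19140): all 70 C7 rows with `qp ≤ 150000` have `S(42p, 448p²) = {1,2,7,14,p,2p,7p,14p}`,
`S' = {1, −7, p, −7p}`, and `r_an(49a1^{(2p)}) = 0 ⇒ ord₂(L/Ω) ∈ {5,7,9}` / `r_an = 2` otherwise. HONEST FRAMING: arithmetic of the even partner on a
density-zero family; no Heegner point, no `L`-value, no case of K12₂″ / twin″ decided; BSD is not proved by any of this.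

References: Silverman, *AEC* (2009), Thm. X.4.2(a), Prop. X.4.9, Prop. X.6.2(b), X.6.5 [SilvermanAEC2009]; Silverman–Tate (2015) §3.5–3.6 [SilvermanTate2015];
Bhargava–Shankar, Ann. of Math. 181 (2015), proof of Prop. 3.18 (Hensel step) [BhargavaShankarAnnals2015].
-/

noncomputable section

open scoped Classical

open WeierstrassCurve Literature.NumberTheory Literature.NumberTheory.EllipticCurves Literature.NumberTheory.DiophantineGeometry
open WeierstrassCurve.Affine (sqClass sqClass_eq_one_iff)

namespace Summit.BirchSwinnertonDyer.BirchSwinnertonDyer.Theorems.GoldfeldGoodTwists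

/-! ## §1 Residue arithmetic at a type-β prime `p ≡ 1 (mod 8)` -/

section Residues

/-- `p ≡ 1 (mod 8)`: `p ≠ 2`, `p ≠ 3`, `p ≠ 7`, `p % 4 = 1`. [folklore] -/
theorem aux_of_mod_eight_one {p : ℕ} (hp8 : p % 8 = 1) : p ≠ 2 ∧ p ≠ 3 ∧ p ≠ 7 ∧ p % 4 = 1 := by
  refine ⟨?_, ?_, ?_, ?_⟩ <;> omega

/-- A natural number `n` with `p ∤ n` is non-zero in `ZMod p`. [folklore] -/
private theorem natCast_ne_zero_of_not_dvd {p n : ℕ} (hnp : ¬ p ∣ n) : (n : ZMod p) ≠ 0 := by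
  rw [Ne, ZMod.natCast_eq_zero_iff]
  exact fun h ↦ hnp h

variable {p : ℕ} [Fact p.Prime]

/-- **A fourth root of `7` modulo a type-β prime `p ≡ 1 (mod 8)`**: `c = x(1+i)/a` with `x⁴ = −7` (β), `i² = −1` (`p ≡ 1 (4)`), `a² = 2`
(`p ≡ 1 (8)`) has `c⁴ = (−7)·(2i)²/4 = 7`. [folklore] -/
theorem exists_pow_four_eq_seven (hp8 : p % 8 = 1) (hβ : ∃ x : ZMod p, x ^ 4 = -7) : ∃ c : ZMod p, c ^ 4 = 7 := by
  have hp : p.Prime := Fact.out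
  obtain ⟨hp2, -, -, hp4⟩ := aux_of_mod_eight_one hp8
  obtain ⟨x, hx⟩ := hβ
  obtain ⟨i, hi⟩ := (ZMod.exists_sq_eq_neg_one_iff (p := p)).mpr (by omega)
  obtain ⟨a, ha⟩ := (ZMod.exists_sq_eq_two_iff hp2).mpr (Or.inl hp8)
  have h2 : (2 : ZMod p) ≠ 0 := by
    have := natCast_ne_zero_of_not_dvd (p := p) (n := 2)
      (fun h ↦ hp2 ((Nat.prime_dvd_prime_iff_eq hp Nat.prime_two).mp h))
    exact_mod_cast this
  have ha0 : a ≠ 0 := by rintro rfl; exact h2 (by rw [ha, mul_zero])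
  refine ⟨x * (1 + i) * a⁻¹, ?_⟩
  have hinv : a⁻¹ * a = 1 := inv_mul_cancel₀ ha0
  have h1i : (1 + i) ^ 2 = 2 * i := by linear_combination (-1 : ZMod p) * hi
  calc (x * (1 + i) * a⁻¹) ^ 4 = x ^ 4 * ((1 + i) ^ 2) ^ 2 * (a⁻¹) ^ 4 := by ring
    _ = (-7) * (2 * i) ^ 2 * (a⁻¹) ^ 4 := by rw [hx, h1i]
    _ = 7 := by linear_combination (28 * (a⁻¹) ^ 4) * hi + (7 * (2 * (a⁻¹) ^ 2 + 1) * (a⁻¹) ^ 2) * ha +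
          (7 * (2 * (a⁻¹) ^ 2 + 1) * (a⁻¹ * a + 1)) * hinv

/-- **The simple root of `g(t) = t⁴ − 84t² − 28` modulo `p`**: `t₀ = c³ + 3c` with `c⁴ = 7` satisfies `g(t₀) = 0` and
`g'(t₀) = 4t₀³ − 168t₀ ≠ 0` (`= 64c³(c² + 3)`; `c ≠ 0` as `p ≠ 7`, `c² ≠ −3` as `p ≠ 2`). [folklore] -/
theorem exists_simple_root_mod_p (hp8 : p % 8 = 1) (hβ : ∃ x : ZMod p, x ^ 4 = -7) :
    ∃ t : ZMod p, t ^ 4 - 84 * t ^ 2 - 28 = 0 ∧ 4 * t ^ 3 - 168 * t ≠ 0 := by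
  have hp : p.Prime := Fact.out
  obtain ⟨hp2, -, hp7, -⟩ := aux_of_mod_eight_one hp8
  obtain ⟨c, hc⟩ := exists_pow_four_eq_seven hp8 hβ
  have h2 : (2 : ZMod p) ≠ 0 := by
    have := natCast_ne_zero_of_not_dvd (p := p) (n := 2)
      (fun h ↦ hp2 ((Nat.prime_dvd_prime_iff_eq hp Nat.prime_two).mp h))
    exact_mod_cast this
  have h7 : (7 : ZMod p) ≠ 0 := by
    have := natCast_ne_zero_of_not_dvd (p := p) (n := 7)
      (fun h ↦ hp7 ((Nat.prime_dvd_prime_iff_eq hp (by norm_num)).mp h))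
    exact_mod_cast this
  have hc0 : c ≠ 0 := by rintro rfl; exact h7 (by rw [← hc]; ring)
  have hc3 : c ^ 2 + 3 ≠ 0 := by
    intro h
    have h9 : c ^ 4 = 9 := by
      have : c ^ 2 = -3 := by linear_combination h
      rw [show c ^ 4 = (c ^ 2) ^ 2 by ring, this]; norm_num
    apply h2
    have h97 : (9 : ZMod p) = 7 := h9.symm.trans hc
    linear_combination h97
  have h64 : (64 : ZMod p) ≠ 0 := by
    rw [show (64 : ZMod p) = 2 ^ 6 by norm_num]; exact pow_ne_zero 6 h2
  refine ⟨c ^ 3 + 3 * c, ?_, ?_⟩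
  · linear_combination (c ^ 8 + 12 * c ^ 6 + 61 * c ^ 4 + 108 * c ^ 2 + 4) * hc
  · rw [show 4 * (c ^ 3 + 3 * c) ^ 3 - 168 * (c ^ 3 + 3 * c) = 64 * c ^ 3 * (c ^ 2 + 3) + (4 * c ^ 5 + 36 * c ^ 3 + 72 * c) * (c ^ 4 - 7) by ring,
      show c ^ 4 - 7 = 0 from sub_eq_zero.mpr hc, mul_zero, add_zero]
    exact mul_ne_zero (mul_ne_zero h64 (pow_ne_zero 3 hc0)) hc3

/-- The simple root modulo `p`, as an INTEGER `T`: `p ∣ T⁴ − 84T² − 28` and `p ∤ 4T³ − 168T`. [folklore] -/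
theorem exists_int_simple_root (hp8 : p % 8 = 1) (hβ : ∃ x : ZMod p, x ^ 4 = -7) :
    ∃ T : ℤ, (p : ℤ) ∣ T ^ 4 - 84 * T ^ 2 - 28 ∧ ¬ (p : ℤ) ∣ 4 * T ^ 3 - 168 * T := by
  obtain ⟨t, ht, ht'⟩ := exists_simple_root_mod_p hp8 hβ
  refine ⟨(t.val : ℤ), ?_, ?_⟩
  · rw [← ZMod.intCast_zmod_eq_zero_iff_dvd]
    push_cast
    rw [ZMod.natCast_zmod_val]
    exact ht
  · rw [← ZMod.intCast_zmod_eq_zero_iff_dvd]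
    push_cast
    rw [ZMod.natCast_zmod_val]
    exact ht'

end Residues

/-! ## §2 Local solubility of `w² = p u⁴ − 84p u²z² − 28p z⁴` everywhere -/

section Local

/-- `Δ(⟨p, 0, −84p, 0, −28p⟩) = −2²⁶·7³·p⁶`. [folklore] -/
theorem disc_quartic_pOne (p : ℕ) :
    (twoIsogenyQuartic (-84 * p) p (-28 * p)).disc = -(2 ^ 26 * 7 ^ 3 * (p : ℤ) ^ 6) := by
  simp only [twoIsogenyQuartic, BinaryQuartic.disc]; ring

/-- `|k|_ℓ = 1` for an integer `k` prime to `ℓ`. [folklore] -/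
private theorem norm_intCast_eq_one_of_not_dvd {q : ℕ} [Fact q.Prime] {k : ℤ} (hk : ¬ (q : ℤ) ∣ k) : ‖(k : ℤ_[q])‖ = 1 :=
  le_antisymm (PadicInt.norm_le_one _) (not_lt.mp fun hlt => hk (PadicInt.norm_intCast_lt_one_iff.mp hlt))

variable {p : ℕ} [Fact p.Prime]

omit [Fact p.Prime] in
/-- A square root `r² = c` in `ℤ_ℓ` of `c = p u⁴ − 84p u² z² − 28p z⁴` (integers `u, z` not both zero) is a `ℚ_ℓ`-point `(u, z, r)`. [folklore] -/
private theorem isSoluble_of_sq {q : ℕ} [Fact q.Prime] {u z c : ℤ} (huz : u ≠ 0 ∨ z ≠ 0)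
    (hc : c = p * u ^ 4 - 84 * p * u ^ 2 * z ^ 2 - 28 * p * z ^ 4) {r : ℤ_[q]} (hr : r ^ 2 = c) :
    ((twoIsogenyQuartic (-84 * p) p (-28 * p)).map (Int.castRingHom ℚ_[q])).IsSoluble := by
  refine ⟨u, z, r, ?_, ?_⟩
  · rcases huz with h | h
    · exact Or.inl (by exact_mod_cast h)
    · exact Or.inr (by exact_mod_cast h)
  · have h := congrArg ((↑) : ℤ_[q] → ℚ_[q]) hr
    push_cast at h
    rw [eval_map_twoIsogenyQuartic, h, hc]
    simp only [eq_intCast]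
    push_cast
    ring

/-- Over `ℝ`: the point `(1, 0, √p)`. [cite: SilvermanAEC2009, Prop. X.4.9] -/
theorem isSoluble_real_quartic_pOne : ((twoIsogenyQuartic (-84 * p) p (-28 * p)).map (Int.castRingHom ℝ)).IsSoluble :=
  isSoluble_real_twoIsogenyQuartic_of_pos (by exact_mod_cast (Fact.out : p.Prime).pos) _ _

omit [Fact p.Prime] in
/-- `ℓ = 2`: the point `(1, 0, √p)`, `p ≡ 1 (mod 8)` being a `2`-adic square. [cite: SilvermanAEC2009, proof of Prop. X.6.2(b) (p ≡ 1 (mod 8))] -/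
theorem isSoluble_two_quartic_pOne (hp8 : p % 8 = 1) :
    ((twoIsogenyQuartic (-84 * p) p (-28 * p)).map (Int.castRingHom ℚ_[2])).IsSoluble := by
  have hmod : PadicInt.toZModPow 3 ((p : ℤ) : ℤ_[2]) = 1 := by
    rw [map_intCast]
    have h1 : ((p : ℤ) : ZMod (2 ^ 3)) = ((p % 8 : ℕ) : ZMod (2 ^ 3)) := by
      rw [show (2 ^ 3 : ℕ) = 8 from rfl, ZMod.natCast_mod]; push_cast; rfl
    rw [h1, hp8, Nat.cast_one]
  obtain ⟨W, hW⟩ := QuadraticForms.padicInt_isSquare_of_toZModPow_three_eq_one (p := 2) hmod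
  exact isSoluble_of_sq (u := 1) (z := 0) (c := p) (Or.inl one_ne_zero) (by ring) (r := W) (by rw [sq, ← hW])

/-- `ℓ = 3`: `(1, 0, √p)` if `p ≡ 1 (mod 3)`, `(0, 1, √(−28p))` if `p ≡ 2 (mod 3)` (unit squares modulo `3` lift). [folklore] -/
theorem isSoluble_three_quartic_pOne (hp8 : p % 8 = 1) :
    ((twoIsogenyQuartic (-84 * p) p (-28 * p)).map (Int.castRingHom ℚ_[3])).IsSoluble := by
  haveI : Fact (Nat.Prime 3) := ⟨Nat.prime_three⟩
  have hp : p.Prime := Fact.out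
  obtain ⟨-, hp3, -, -⟩ := aux_of_mod_eight_one hp8
  have hmod3 : p % 3 = 1 ∨ p % 3 = 2 := by
    have h : p % 3 ≠ 0 := by
      intro h0
      rcases (Nat.dvd_prime hp).mp (Nat.dvd_of_mod_eq_zero h0) with h | h
      · norm_num at h
      · exact hp3 h.symm
    omega
  rcases hmod3 with h1 | h2
  · obtain ⟨r, hr⟩ := LindMordellQuartics.exists_sq_eq_intCast (q := 3) (by norm_num) (c := p) (w := 1) (by norm_num) (by omega)
    exact isSoluble_of_sq (u := 1) (z := 0) (c := p) (Or.inl one_ne_zero) (by ring) hr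
  · obtain ⟨r, hr⟩ := LindMordellQuartics.exists_sq_eq_intCast (q := 3) (by norm_num) (c := -28 * p) (w := 1) (by norm_num) (by omega)
    exact isSoluble_of_sq (u := 0) (z := 1) (c := -28 * p) (Or.inr one_ne_zero) (by ring) hr

/-- `ℓ = 7`: the point `(1, 0, √p)`, `p` being a non-zero square modulo `7` (`(p/7) = (−7/p) = +1` for `p ≡ 1 (mod 4)`). [folklore] -/
theorem isSoluble_seven_quartic_pOne (hp8 : p % 8 = 1) (hp7 : legendreSym p (-7) = 1) :
    ((twoIsogenyQuartic (-84 * p) p (-28 * p)).map (Int.castRingHom ℚ_[7])).IsSoluble := by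
  haveI : Fact (Nat.Prime 7) := ⟨by norm_num⟩
  have hp : p.Prime := Fact.out
  obtain ⟨hp2, -, hp7', -⟩ := aux_of_mod_eight_one hp8
  have hjac : jacobiSym p 7 = 1 := by rw [← legendreSym_neg_seven_eq_jacobiSym hp2]; exact hp7
  have hleg : legendreSym 7 p = 1 := by rw [jacobiSym.legendreSym.to_jacobiSym]; exact_mod_cast hjac
  have hndvd : ¬ (7 : ℤ) ∣ p := by
    intro h
    exact hp7' ((Nat.prime_dvd_prime_iff_eq (by norm_num) hp).mp (by exact_mod_cast h)).symm
  have hp0 : ((p : ℤ) : ZMod 7) ≠ 0 := by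
    rw [Ne, ZMod.intCast_zmod_eq_zero_iff_dvd]; exact hndvd
  have hsq : IsSquare ((p : ℤ) : ZMod 7) := (legendreSym.eq_one_iff 7 hp0).mp hleg
  obtain ⟨r, hr⟩ := LindMordellQuartics.exists_sq_eq_intCast_of_isSquare (q := 7) (by norm_num) (c := p) hndvd hsq
  exact isSoluble_of_sq (u := 1) (z := 0) (c := p) (Or.inl one_ne_zero) (by ring) hr

/-- **`ℓ = p`: the point `(t, 1, 0)` with `g(t) = t⁴ − 84t² − 28 = 0` in `ℤ_p`** — Hensel from the simple root `t₀ = c³ + 3c` (`c⁴ = 7`) modulo `p`;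
the only place where type β is used. [cite: BhargavaShankarAnnals2015, Prop. 5.13, proof (Hensel step)] -/
theorem isSoluble_self_quartic_pOne (hp8 : p % 8 = 1) (hβ : ∃ x : ZMod p, x ^ 4 = -7) :
    ((twoIsogenyQuartic (-84 * p) p (-28 * p)).map (Int.castRingHom ℚ_[p])).IsSoluble := by
  obtain ⟨T, hT, hT'⟩ := exists_int_simple_root hp8 hβ
  set G : BinaryQuartic ℤ_[p] := ⟨1, 0, -84, 0, -28⟩ with hG
  have hev : ∀ t : ℤ_[p], G.eval t 1 = t ^ 4 - 84 * t ^ 2 - 28 := by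
    intro t; simp only [hG, BinaryQuartic.eval]; ring
  have h0 : ‖G.eval (T : ℤ_[p]) 1‖ < 1 := by
    rw [hev, show ((T : ℤ_[p]) ^ 4 - 84 * (T : ℤ_[p]) ^ 2 - 28) = ((T ^ 4 - 84 * T ^ 2 - 28 : ℤ) : ℤ_[p]) by push_cast; ring]
    exact PadicInt.norm_intCast_lt_one_iff.mpr hT
  have h1 : ‖4 * G.a * (T : ℤ_[p]) ^ 3 + 3 * G.b * (T : ℤ_[p]) ^ 2 + 2 * G.c * (T : ℤ_[p]) + G.d‖ = 1 := by
    rw [show 4 * G.a * (T : ℤ_[p]) ^ 3 + 3 * G.b * (T : ℤ_[p]) ^ 2 + 2 * G.c * (T : ℤ_[p]) + G.d =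
        ((4 * T ^ 3 - 168 * T : ℤ) : ℤ_[p]) by simp only [hG]; push_cast; ring]
    exact norm_intCast_eq_one_of_not_dvd hT'
  obtain ⟨t, ht⟩ := BinaryQuartic.exists_eval_eq_zero_of_simple_root G h0 h1
  rw [hev] at ht
  have h : (t : ℚ_[p]) ^ 4 - 84 * (t : ℚ_[p]) ^ 2 - 28 = 0 := by
    have h' := congrArg ((↑) : ℤ_[p] → ℚ_[p]) ht
    push_cast at h'
    exact_mod_cast h'
  refine ⟨t, 1, 0, Or.inr one_ne_zero, ?_⟩
  rw [eval_map_twoIsogenyQuartic]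
  simp only [eq_intCast]
  push_cast
  linear_combination (-(p : ℚ_[p])) * h

/-- `ℓ ∤ 2²⁶·7³·p⁶` for a prime `ℓ ≥ 5`, `ℓ ≠ 7`, `ℓ ≠ p`. [folklore] -/
private theorem not_dvd_disc {q : ℕ} [Fact q.Prime] (hq5 : 5 ≤ q) (hq7 : q ≠ 7) (hqp : q ≠ p) :
    ¬ (q : ℤ) ∣ 2 ^ 26 * 7 ^ 3 * (p : ℤ) ^ 6 := by
  intro h
  have hq : q.Prime := Fact.out
  have h' : q ∣ 2 ^ 26 * 7 ^ 3 * p ^ 6 := by exact_mod_cast h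
  rcases (Nat.Prime.dvd_mul hq).mp h' with h27 | hp6
  · rcases (Nat.Prime.dvd_mul hq).mp h27 with h2 | h7
    · have := (Nat.prime_dvd_prime_iff_eq hq Nat.prime_two).mp (hq.dvd_of_dvd_pow h2); omega
    · exact hq7 ((Nat.prime_dvd_prime_iff_eq hq (by norm_num)).mp (hq.dvd_of_dvd_pow h7))
  · exact hqp ((Nat.prime_dvd_prime_iff_eq hq Fact.out).mp (hq.dvd_of_dvd_pow hp6))

/-- Good reduction at a prime `ℓ ≥ 5`, `ℓ ∉ {7, p}`: `ℓ ∤ Δ`, so the form is `ℚ_ℓ`-soluble by the tree's PROVED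
`BinaryQuartic.isSoluble_padic_of_not_dvd_disc` (a smooth genus-one quartic over `𝔽_ℓ` has a point; Hensel). [cite: SilvermanAEC2009, Prop. X.4.9 (solubility is automatic outside 2, ∞ and the primes of bad reduction)] -/
theorem isSoluble_padic_of_five_le_quartic_pOne {q : ℕ} [Fact q.Prime] (hq5 : 5 ≤ q) (hq7 : q ≠ 7) (hqp : q ≠ p) :
    ((twoIsogenyQuartic (-84 * p) p (-28 * p)).map (Int.castRingHom ℚ_[q])).IsSoluble := by
  refine BinaryQuartic.isSoluble_padic_of_not_dvd_disc hq5 _ ?_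
  rw [disc_quartic_pOne, dvd_neg]
  exact not_dvd_disc hq5 hq7 hqp

/-- **`w² = p u⁴ − 84p u²z² − 28p z⁴` is `ℚ_ℓ`-soluble for every prime `ℓ`** (`p ≡ 1 (mod 8)`, `(−7/p) = +1`, type β).
[cite: SilvermanAEC2009, Prop. X.4.9 and proof of Prop. X.6.2(b)] -/
theorem isSoluble_padic_quartic_pOne (hp8 : p % 8 = 1) (hp7 : legendreSym p (-7) = 1) (hβ : ∃ x : ZMod p, x ^ 4 = -7)
    (q : ℕ) [Fact q.Prime] : ((twoIsogenyQuartic (-84 * p) p (-28 * p)).map (Int.castRingHom ℚ_[q])).IsSoluble := by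
  have hq : q.Prime := Fact.out
  by_cases hqp : q = p
  · subst hqp; exact isSoluble_self_quartic_pOne hp8 hβ
  by_cases hq7 : q = 7
  · subst hq7; exact isSoluble_seven_quartic_pOne hp8 hp7
  by_cases h5 : 5 ≤ q
  · exact isSoluble_padic_of_five_le_quartic_pOne h5 hq7 hqp
  · have h5' : q < 5 := not_le.mp h5
    interval_cases q
    · exact absurd hq (by decide)
    · exact absurd hq (by decide)
    · exact isSoluble_two_quartic_pOne hp8
    · exact isSoluble_three_quartic_pOne hp8
    · exact absurd hq (by decide)

/-- **The homogeneous space of the class `p` is everywhere locally soluble.** [cite: SilvermanAEC2009, Prop. X.4.9] -/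
theorem isLocallySoluble_quartic_pOne (hp8 : p % 8 = 1) (hp7 : legendreSym p (-7) = 1) (hβ : ∃ x : ZMod p, x ^ 4 = -7) :
    (twoIsogenyQuartic (-84 * p) p (-28 * p)).IsLocallySoluble :=
  ⟨isSoluble_real_quartic_pOne, fun q _ => isSoluble_padic_quartic_pOne hp8 hp7 hβ q⟩

end Local


end Summit.BirchSwinnertonDyer.BirchSwinnertonDyer.Theorems.GoldfeldGoodTwists

end
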